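import Mathlib
import Summits.KontsevichZagierPeriods.Zeta5Search.BrickResidueLawMain
import Summits.KontsevichZagierPeriods.Zeta5Search.GaussWilsonBlock

/-!
# BrickLambdaClosedForm — THEOREM 7 LEMMA 3 (iii) for the ° cells: the CLOSED FORM of the multiplier through unit
factorials, `λ_j·U_j = ±(n/2 − j)^ε·Y_j` (Legendre digit-stripping, exact; cell zeta5-irr)

HONEST FRAMING: systematic search; no irrationality claim unless certified. INSTRUMENT lemmas of the ζ(5)
census cell zeta5-irr (HOME `run/shared/lean/pub/zeta5-irr/`; memo `zi-p2/probes/B8/thm7/THEOREM7.md` §2 LEMMA 2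
(2.2) «C(N,K)/C(N′,K′) = [p·y_h]^{c_h}·ρ₁°, C(N+K,K)/C(N′+K′,K′) = [p·y_a]^{c_a}·ρ₂°, C(2N−K,N)/C(2N′−K′,N′) =
[p·y_b]^{[δ_b=1]}·…·ρ₃° with the p-adic UNITS ρ₁° := N!_p/(K!_p(N−K)!_p), ρ₂° := (N+K)!_p/(K!_pN!_p), ρ₃° :=
(2N−K)!_p/(N!_p(N−K)!_p)» and LEMMA 3 «(iii) CLOSED FORM for c_h = 0 … (v) DIGIT-LOCALITY: for every e ≥ 1 and cells
K, K* = K + p^et ≤ N with K₀ ≤ N₀ … λ_{K*} ≡ λ_K (mod p^e). Proof: by (W), each of K*!_p/K!_p, …, is a product over t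
blocks of p^e consecutive integers, hence ≡ (−1)^t (mod p^e) … the signs (−1)^t cancel in pairs»;
`zi-p2/probes/B8/thm8/THEOREM8.md` fact (°), Q-3). Nothing here is about ζ(5); no irrationality content; filing moves no
rung. Filed by the engine seat zi-eng (g9); inputs: `GaussWilsonBlock.unitFactorial_shift_iter` (zi-p2's SketchT7,
filed by zi-eng g8: `(N + p^e·t)!_p ≡ (−1)^t·N!_p (mod p^e)`), Legendre one step `m! = p^{m/p}·(m/p)!·m!_p` (proved here).

## The statements (digits written subtraction-free: `n₀ = j₀ + m₀`, `N = J + M`, so `n − j = m₀ + Mp`)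

* `factorial_eq_unitFactorial`: `m! = p^{m/p}·(m/p)!·m!_p` (`m!_p = GaussWilsonBlock.unitFactorial p m`);
  `not_dvd_unitFactorial`: `p ∤ m!_p`.
* (2.2) for a ° cell, exact in `ℕ`: `choose_mul_uf` (`C(n,j)·j!_p·(n−j)!_p = C(N,J)·n!_p`), `choose_add_mul_uf`
  (`C(n+j,j)·j!_p·n!_p = (p·y_a)^{c_a}·C(N+J,J)·(n+j)!_p`), `choose_two_sub_mul_uf`
  (`C(2n−j,n)·n!_p·(n−j)!_p = (p·y_b)^{c_b}·C(2N−J,N)·(2n−j)!_p`).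
* **`lambda_mul_unitPart`** (LEMMA 3 (iii)): `λ_j·U_j = (−1)^{nB+jA}(−1)^{NB+JA}·(n/2 − j)^ε·Y_j` with the unit
  `U_j = (j!_p(n−j)!_p)^A(j!_p n!_p)^B(n!_p(n−j)!_p)^B` and `Y_j = (n!_p)^A((p y_a)^{c_a}(n+j)!_p)^B((p y_b)^{c_b}(2n−j)!_p)^B`.
The digit-locality (LEMMA 3 (v)) is the sequel file `BrickLambdaLocality`.
-/

namespace Summit.KontsevichZagierPeriods.Zeta5Search.BrickLambdaClosedForm

open Finset Nat WithZero
open Summit.KontsevichZagierPeriods.Zeta5Search.BrickTopCoefficient (cTop)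
open Summit.KontsevichZagierPeriods.Zeta5Search.BrickLambda (cTop_zero_ne_zero padicValuation_two le_one_of_cong)
open Summit.KontsevichZagierPeriods.Zeta5Search.BrickResidueLawMain (cong_mul_le)
open Summit.KontsevichZagierPeriods.Zeta5Search.GaussWilsonBlock (unitFactorial unitBlockProd
  unitFactorial_shift_iter)
open Literature.NumberTheory.LFunctions (padicValuation_natCast_eq_one padicValuation_natCast_le_one)

variable {p : ℕ} [Fact p.Prime]

/-! ## Legendre one step through the unit factorial -/

omit [Fact p.Prime] in
/-- `0!_p = 1`. -/
theorem unitFactorial_zero : unitFactorial p 0 = 1 := by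
  unfold unitFactorial unitBlockProd; simp

omit [Fact p.Prime] in
/-- `(m+1)!_p = m!_p·(m+1)` if `p ∤ m+1`, `= m!_p` if `p ∣ m+1`. -/
theorem unitFactorial_succ (m : ℕ) :
    unitFactorial p (m + 1) = unitFactorial p m * (if p ∣ m + 1 then 1 else m + 1) := by
  unfold unitFactorial unitBlockProd
  rw [Finset.prod_filter, Finset.prod_filter, Finset.prod_Ioc_succ_top (Nat.zero_le m)]
  split_ifs <;> rfl

/-- **Legendre, one step**: `m! = p^{m/p}·(m/p)!·m!_p`. -/
theorem factorial_eq_unitFactorial (m : ℕ) : m ! = p ^ (m / p) * (m / p)! * unitFactorial p m := by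
  have hp : p.Prime := Fact.out
  induction m with
  | zero => simp [unitFactorial_zero, Nat.div_eq_of_lt hp.pos]
  | succ m ih =>
    rw [Nat.factorial_succ, ih, unitFactorial_succ, Nat.succ_div]
    by_cases h : p ∣ m + 1
    · obtain ⟨c, hc⟩ := h
      have hc' : (m + 1) / p = c := by rw [hc, Nat.mul_div_cancel_left _ hp.pos]
      rw [if_pos ⟨c, hc⟩, if_pos ⟨c, hc⟩, pow_succ, Nat.factorial_succ, show m / p + 1 = c by rw [← hc', Nat.succ_div,
        if_pos ⟨c, hc⟩], hc]
      ring
    · rw [if_neg h, if_neg h, add_zero]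
      ring

/-- `p ∤ m!_p`. -/
theorem not_dvd_unitFactorial (m : ℕ) : ¬ p ∣ unitFactorial p m := by
  have hp : p.Prime := Fact.out
  unfold unitFactorial unitBlockProd
  intro h
  obtain ⟨i, hi, hpi⟩ := (Prime.dvd_finsetProd_iff hp.prime _).1 h
  exact (mem_filter.1 hi).2 hpi

/-- `v(m!_p) = 1`. -/
theorem padicValuation_unitFactorial (m : ℕ) : Rat.padicValuation p (unitFactorial p m : ℚ) = 1 :=
  padicValuation_natCast_eq_one (not_dvd_unitFactorial m)

/-! ## (2.2): the three binomials of a ° cell against unit factorials, exactly -/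

section rho

variable {j₀ m₀ : ℕ} (hn₀ : j₀ + m₀ < p) (J M : ℕ)
include hn₀

/-- `C(n,j)·j!_p·(n−j)!_p = C(N,J)·n!_p` (`n = n₀ + Np`, `j = j₀ + Jp`, `n₀ = j₀ + m₀ < p`, `N = J + M`). -/
theorem choose_mul_uf :
    (j₀ + m₀ + (J + M) * p).choose (j₀ + J * p) * unitFactorial p (j₀ + J * p) * unitFactorial p (m₀ + M * p) =
      (J + M).choose J * unitFactorial p (j₀ + m₀ + (J + M) * p) := by
  have hp : p.Prime := Fact.out
  have h1 := Nat.add_choose_mul_factorial_mul_factorial (m₀ + M * p) (j₀ + J * p)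
  have e0 : m₀ + M * p + (j₀ + J * p) = j₀ + m₀ + (J + M) * p := by ring
  rw [e0] at h1
  have hj := factorial_eq_unitFactorial (p := p) (j₀ + J * p)
  have hm := factorial_eq_unitFactorial (p := p) (m₀ + M * p)
  have hn := factorial_eq_unitFactorial (p := p) (j₀ + m₀ + (J + M) * p)
  rw [Nat.add_mul_div_right _ _ hp.pos, Nat.div_eq_of_lt (by omega), zero_add] at hj hm hn
  have h2 := Nat.add_choose_mul_factorial_mul_factorial M J
  rw [add_comm M J] at h2
  have hp0 : 0 < p := hp.pos
  have hD : 0 < p ^ (J + M) * J ! * M ! := by positivity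
  refine Nat.eq_of_mul_eq_mul_right hD ?_
  calc _ = (j₀ + m₀ + (J + M) * p).choose (j₀ + J * p) * (p ^ J * J ! * unitFactorial p (j₀ + J * p)) *
        (p ^ M * M ! * unitFactorial p (m₀ + M * p)) := by ring
    _ = (j₀ + m₀ + (J + M) * p)! := by rw [← hj, ← hm, ← h1]; ring
    _ = _ := by rw [hn, ← h2]; ring

/-- `C(n+j,j)·j!_p·n!_p = (p(N+J+1))^{c_a}·C(N+J,J)·(n+j)!_p`, `c_a = (n₀+j₀)/p`. -/
theorem choose_add_mul_uf :
    (j₀ + m₀ + (J + M) * p + (j₀ + J * p)).choose (j₀ + J * p) * unitFactorial p (j₀ + J * p) *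
        unitFactorial p (j₀ + m₀ + (J + M) * p) =
      (p * (J + M + J + 1)) ^ ((j₀ + m₀ + j₀) / p) * (J + M + J).choose J *
        unitFactorial p (j₀ + m₀ + (J + M) * p + (j₀ + J * p)) := by
  have hp : p.Prime := Fact.out
  set ca := (j₀ + m₀ + j₀) / p with hca
  have hca1 : ca ≤ 1 := Nat.lt_succ_iff.1 ((Nat.div_lt_iff_lt_mul hp.pos).2 (by omega))
  have h1 := Nat.add_choose_mul_factorial_mul_factorial (j₀ + m₀ + (J + M) * p) (j₀ + J * p)
  have hj := factorial_eq_unitFactorial (p := p) (j₀ + J * p)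
  have hn := factorial_eq_unitFactorial (p := p) (j₀ + m₀ + (J + M) * p)
  have hs := factorial_eq_unitFactorial (p := p) (j₀ + m₀ + (J + M) * p + (j₀ + J * p))
  rw [Nat.add_mul_div_right _ _ hp.pos, Nat.div_eq_of_lt (by omega), zero_add] at hj hn
  have e0 : j₀ + m₀ + (J + M) * p + (j₀ + J * p) = j₀ + m₀ + j₀ + (J + M + J) * p := by ring
  rw [e0, Nat.add_mul_div_right _ _ hp.pos, ← hca, ← e0] at hs
  have h2 := Nat.add_choose_mul_factorial_mul_factorial (J + M) J
  have h5 : (ca + (J + M + J))! = (J + M + J + 1) ^ ca * (J + M + J)! := by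
    interval_cases ca
    · simp
    · rw [show 1 + (J + M + J) = (J + M + J) + 1 by ring, Nat.factorial_succ, pow_one]
  have hp0 : 0 < p := hp.pos
  have hD : 0 < p ^ (J + M + J) * (J + M)! * J ! := by positivity
  refine Nat.eq_of_mul_eq_mul_right hD ?_
  calc _ = (j₀ + m₀ + (J + M) * p + (j₀ + J * p)).choose (j₀ + J * p) *
        (p ^ (J + M) * (J + M)! * unitFactorial p (j₀ + m₀ + (J + M) * p)) *
        (p ^ J * J ! * unitFactorial p (j₀ + J * p)) := by ring
    _ = (j₀ + m₀ + (J + M) * p + (j₀ + J * p))! := by rw [← hj, ← hn, ← h1]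
    _ = _ := by rw [hs, h5, ← h2, mul_pow]; ring

/-- `C(2n−j,n)·n!_p·(n−j)!_p = (p(2N−J+1))^{c_b}·C(2N−J,N)·(2n−j)!_p`, `c_b = (n₀+(n₀−j₀))/p` (`2n − j = (n−j) + n`). -/
theorem choose_two_sub_mul_uf :
    (m₀ + M * p + (j₀ + m₀ + (J + M) * p)).choose (j₀ + m₀ + (J + M) * p) *
        unitFactorial p (j₀ + m₀ + (J + M) * p) * unitFactorial p (m₀ + M * p) =
      (p * (J + M + M + 1)) ^ ((j₀ + m₀ + m₀) / p) * (M + (J + M)).choose (J + M) *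
        unitFactorial p (m₀ + M * p + (j₀ + m₀ + (J + M) * p)) := by
  have hp : p.Prime := Fact.out
  set cb := (j₀ + m₀ + m₀) / p with hcb
  have hcb1 : cb ≤ 1 := Nat.lt_succ_iff.1 ((Nat.div_lt_iff_lt_mul hp.pos).2 (by omega))
  have h1 := Nat.add_choose_mul_factorial_mul_factorial (m₀ + M * p) (j₀ + m₀ + (J + M) * p)
  have hm := factorial_eq_unitFactorial (p := p) (m₀ + M * p)
  have hn := factorial_eq_unitFactorial (p := p) (j₀ + m₀ + (J + M) * p)
  have hs := factorial_eq_unitFactorial (p := p) (m₀ + M * p + (j₀ + m₀ + (J + M) * p))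
  rw [Nat.add_mul_div_right _ _ hp.pos, Nat.div_eq_of_lt (by omega), zero_add] at hm hn
  have e0 : m₀ + M * p + (j₀ + m₀ + (J + M) * p) = j₀ + m₀ + m₀ + (J + M + M) * p := by ring
  rw [e0, Nat.add_mul_div_right _ _ hp.pos, ← hcb, ← e0] at hs
  have h2 := Nat.add_choose_mul_factorial_mul_factorial M (J + M)
  have e1 : M + (J + M) = J + M + M := by ring
  have h5 : (cb + (J + M + M))! = (J + M + M + 1) ^ cb * (M + (J + M))! := by
    rw [e1]
    interval_cases cb
    · simp
    · rw [show 1 + (J + M + M) = (J + M + M) + 1 by ring, Nat.factorial_succ, pow_one]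
  have hp0 : 0 < p := hp.pos
  have hD : 0 < p ^ (J + M + M) * M ! * (J + M)! := by positivity
  refine Nat.eq_of_mul_eq_mul_right hD ?_
  calc _ = (m₀ + M * p + (j₀ + m₀ + (J + M) * p)).choose (j₀ + m₀ + (J + M) * p) *
        (p ^ M * M ! * unitFactorial p (m₀ + M * p)) *
        (p ^ (J + M) * (J + M)! * unitFactorial p (j₀ + m₀ + (J + M) * p)) := by ring
    _ = (m₀ + M * p + (j₀ + m₀ + (J + M) * p))! := by rw [← hm, ← hn, ← h1]
    _ = _ := by rw [hs, h5, ← h2, mul_pow]; ring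

end rho

/-! ## LEMMA 3 (iii): the closed form `λ_j·U_j = ±(n/2 − j)^ε·Y_j` -/

/-- The UNIT PART `U_j = (j!_p(n−j)!_p)^A·(j!_p n!_p)^B·(n!_p(n−j)!_p)^B ∈ ℕ` (denominators of `ρ₁^A ρ₂^B ρ₃^B`) of the
° cell with digits `n₀ = j₀ + m₀`, `N = J + M` (`n = n₀ + Np`, `j = j₀ + Jp`, `n − j = m₀ + Mp`). -/
def unitPart (p A B j₀ m₀ J M : ℕ) : ℕ :=
  (unitFactorial p (j₀ + J * p) * unitFactorial p (m₀ + M * p)) ^ A *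
    (unitFactorial p (j₀ + J * p) * unitFactorial p (j₀ + m₀ + (J + M) * p)) ^ B *
    (unitFactorial p (j₀ + m₀ + (J + M) * p) * unitFactorial p (m₀ + M * p)) ^ B

/-- The GAINED PART `Y_j = (n!_p)^A·((p y_a)^{c_a}(n+j)!_p)^B·((p y_b)^{c_b}(2n−j)!_p)^B ∈ ℕ` (numerators of
`ρ₁^A ρ₂^B ρ₃^B` with the paid gained members `p·y_a = p(N+J+1)`, `p·y_b = p(2N−J+1)`). -/
def gainPart (p A B j₀ m₀ J M : ℕ) : ℕ :=
  unitFactorial p (j₀ + m₀ + (J + M) * p) ^ A *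
    ((p * (J + M + J + 1)) ^ ((j₀ + m₀ + j₀) / p) * unitFactorial p (j₀ + m₀ + (J + M) * p + (j₀ + J * p))) ^ B *
    ((p * (J + M + M + 1)) ^ ((j₀ + m₀ + m₀) / p) * unitFactorial p (m₀ + M * p + (j₀ + m₀ + (J + M) * p))) ^ B

/-- `U_j` is a `p`-adic unit. -/
theorem padicValuation_unitPart (A B j₀ m₀ J M : ℕ) :
    Rat.padicValuation p (unitPart p A B j₀ m₀ J M : ℚ) = 1 := by
  unfold unitPart
  push_cast
  simp only [map_mul, map_pow, padicValuation_unitFactorial, one_pow, mul_one]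

section closed

variable {A B ε j₀ m₀ J M : ℕ} (hn₀ : j₀ + m₀ < p)
include hn₀

/-- `cTop A B ε n j·U_j = (−1)^{nB+jA}·(n/2 − j)^ε·Y_j·[C(N,J)^A(C(N+J,J)C(2N−J,N))^B]`. -/
theorem cTop_mul_unitPart :
    cTop A B ε (j₀ + m₀ + (J + M) * p) (j₀ + J * p) * (unitPart p A B j₀ m₀ J M : ℚ) =
      (-1) ^ ((j₀ + m₀ + (J + M) * p) * B + (j₀ + J * p) * A) *
        (((j₀ + m₀ + (J + M) * p : ℕ) : ℚ) / 2 - ((j₀ + J * p : ℕ) : ℚ)) ^ ε * (gainPart p A B j₀ m₀ J M : ℚ) *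
        ((((J + M).choose J) ^ A * (((J + M + J).choose J) * ((M + (J + M)).choose (J + M))) ^ B : ℕ) : ℚ) := by
  have hρ1 := congrArg (fun x : ℕ => (x : ℚ)) (choose_mul_uf (p := p) hn₀ J M)
  have hρ2 := congrArg (fun x : ℕ => (x : ℚ)) (choose_add_mul_uf (p := p) hn₀ J M)
  have hρ3 := congrArg (fun x : ℕ => (x : ℚ)) (choose_two_sub_mul_uf (p := p) hn₀ J M)
  simp only [Nat.cast_mul, Nat.cast_pow] at hρ1 hρ2 hρ3
  have e2 : 2 * (j₀ + m₀ + (J + M) * p) - (j₀ + J * p) = m₀ + M * p + (j₀ + m₀ + (J + M) * p) := by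
    zify [show j₀ + J * p ≤ 2 * (j₀ + m₀ + (J + M) * p) by nlinarith]
    ring
  unfold cTop unitPart gainPart
  rw [e2]
  push_cast
  set u1 : ℚ := ((unitFactorial p (j₀ + J * p) : ℕ) : ℚ)
  set u2 : ℚ := ((unitFactorial p (m₀ + M * p) : ℕ) : ℚ)
  set u3 : ℚ := ((unitFactorial p (j₀ + m₀ + (J + M) * p) : ℕ) : ℚ)
  calc _ = (-1) ^ ((j₀ + m₀ + (J + M) * p) * B + (j₀ + J * p) * A) *
        (((j₀ + m₀ + (J + M) * p : ℕ) : ℚ) / 2 - ((j₀ + J * p : ℕ) : ℚ)) ^ ε *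
        ((((j₀ + m₀ + (J + M) * p).choose (j₀ + J * p) : ℕ) : ℚ) * u1 * u2) ^ A *
        (((((j₀ + m₀ + (J + M) * p + (j₀ + J * p)).choose (j₀ + J * p) : ℕ) : ℚ) * u1 * u3) *
          ((((m₀ + M * p + (j₀ + m₀ + (J + M) * p)).choose (j₀ + m₀ + (J + M) * p) : ℕ) : ℚ) * u3 * u2)) ^ B := by
        push_cast; ring
    _ = _ := by rw [hρ1, hρ2, hρ3]; push_cast; ring

/-- **LEMMA 3 (iii), closed form**: any `λ` with `λ·c̃_{J,A}(N) = c_{j,A}(n)` satisfies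
`λ·U_j = (−1)^{nB+jA}·(−1)^{NB+JA}·(n/2 − j)^ε·Y_j`. -/
theorem lambda_mul_unitPart {lam : ℚ}
    (hlam : lam * cTop A B 0 (J + M) J = cTop A B ε (j₀ + m₀ + (J + M) * p) (j₀ + J * p)) :
    lam * (unitPart p A B j₀ m₀ J M : ℚ) =
      (-1) ^ ((j₀ + m₀ + (J + M) * p) * B + (j₀ + J * p) * A) * (-1) ^ ((J + M) * B + J * A) *
        (((j₀ + m₀ + (J + M) * p : ℕ) : ℚ) / 2 - ((j₀ + J * p : ℕ) : ℚ)) ^ ε * (gainPart p A B j₀ m₀ J M : ℚ) := by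
  have hTne : ((((J + M).choose J) ^ A * (((J + M + J).choose J) * ((M + (J + M)).choose (J + M))) ^ B : ℕ) : ℚ) ≠ 0 := by
    have h1 : 0 < (J + M).choose J := Nat.choose_pos (Nat.le_add_right J M)
    have h2 : 0 < (J + M + J).choose J := Nat.choose_pos (by omega)
    have h3 : 0 < (M + (J + M)).choose (J + M) := Nat.choose_pos (Nat.le_add_left _ _)
    positivity
  have h0 : cTop A B 0 (J + M) J = (-1) ^ ((J + M) * B + J * A) *
      ((((J + M).choose J) ^ A * (((J + M + J).choose J) * ((M + (J + M)).choose (J + M))) ^ B : ℕ) : ℚ) := by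
    unfold cTop
    rw [pow_zero, mul_one, show J + M + J = (J + M) + J by ring, show M + (J + M) = 2 * (J + M) - J by omega]
    push_cast; ring
  have key := cTop_mul_unitPart (p := p) (A := A) (B := B) (ε := ε) (J := J) (M := M) hn₀
  set U : ℚ := (unitPart p A B j₀ m₀ J M : ℚ) with hU
  set Y : ℚ := (gainPart p A B j₀ m₀ J M : ℚ) with hY
  set T : ℚ := ((((J + M).choose J) ^ A * (((J + M + J).choose J) * ((M + (J + M)).choose (J + M))) ^ B : ℕ) : ℚ)
    with hT
  set c : ℚ := (((j₀ + m₀ + (J + M) * p : ℕ) : ℚ) / 2 - ((j₀ + J * p : ℕ) : ℚ)) with hc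
  have hs' : ((-1 : ℚ) ^ ((J + M) * B + J * A)) * (-1) ^ ((J + M) * B + J * A) = 1 := by
    rw [← pow_add, ← two_mul, pow_mul, neg_one_sq, one_pow]
  apply mul_right_cancel₀ hTne
  calc lam * U * T = lam * U * T * (((-1 : ℚ) ^ ((J + M) * B + J * A)) * (-1) ^ ((J + M) * B + J * A)) := by
        rw [hs', mul_one]
    _ = lam * ((-1) ^ ((J + M) * B + J * A) * T) * U * (-1) ^ ((J + M) * B + J * A) := by ring
    _ = cTop A B ε (j₀ + m₀ + (J + M) * p) (j₀ + J * p) * U * (-1) ^ ((J + M) * B + J * A) := by rw [← h0, hlam]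
    _ = (-1) ^ ((j₀ + m₀ + (J + M) * p) * B + (j₀ + J * p) * A) * c ^ ε * Y * T * (-1) ^ ((J + M) * B + J * A) := by
        rw [key]
    _ = _ := by ring

end closed

end Summit.KontsevichZagierPeriods.Zeta5Search.BrickLambdaClosedForm
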